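import Literature.Analysis.FluidPDE.HouWangYang2025Nonuniqueness
import Mathlib.Analysis.Calculus.Deriv.Basic
import HarnessLib

/-!
# Jia–Šverák 2015: the conditional non-uniqueness theorems for Leray–Hopf solutions, typed verbatim

Statement-level reproduction of H. Jia, V. Šverák, *Are the incompressible 3d Navier–Stokes equations
locally ill-posed in the natural energy space?*, J. Funct. Anal. 268 (2015) 3734–3766 (arXiv:1306.2136;
page numbers below are arXiv-PDF pages) [JiaSverak2015] — the PUBLISHED conditional theorems of the
programme "unstable self-similar profile ⇒ non-uniqueness of Leray–Hopf solutions of the UNFORCED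
equations": Thm. 5.1 (spectral condition (A), a Hopf-type crossing along a curve `σ ↦ U_σ` of
self-similar profiles ⇒ two distinct Leray–Hopf solutions) and Thm. 5.2 (condition (B), a real simple
crossing, plus two non-degeneracy conditions ⇒ the same with compactly supported datum).

Mathlib and the tree have no unbounded-operator spectral theory for the similarity-variable linearisation
`𝓛_U φ = Δφ + (x/2)·∇φ + φ/2 − U·∇φ − φ·∇U + ∇P` on `X = {φ ∈ L²∩L⁴ : div φ = 0}` (JS15 p.2–4; in
the tree the same operator, with the opposite sign and for a smooth compactly supported profile, is
`Literature.Analysis.FluidPDE.negLss` of `NSLerayHopfABCEigenmode.lean`). We therefore type the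
theorems at the level at which they are STATED: an abstract `Setting` carries the objects the hypotheses
quantify over (the base branch `σ ↦ U_σ`, the eigenvalue set of `𝓛_σ = 𝓛 − 𝒦(U_σ)` on the full domain
`𝒟`, simplicity, the range of `𝓛_{σ₀}`, the two non-degeneracy vectors), the spectral conditions (A),
(B), ND1, ND2 are Props over it, and the CONCLUSION is the concrete tree statement `∃ T v₀ u v, 0 < T ∧ JS15Datum v₀ ∧ IsNonUniqLHPair T v₀ u v`
(two distinct strict-sense Leray–Hopf solutions `IsLerayHopfOn` with a common datum, viscosity `1`, no
force, on `ℝ³ × [0, T)`), which implies the tree's statement ns.S19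
`Literature.Analysis.FluidPDE.LerayHopfNonUniqueness` granted the standard continuation of Leray–Hopf
solutions to global ones (`lerayHopfNonUniqueness_of_local`, through
`LerayHopfNonUniqueness.of_isLerayHopfOn` of `HouWangYang2025Nonuniqueness.lean`).

SIGN: JS15 sign throughout — unstable ⇔ `Re λ > 0`. Guillod–Šverák 2023 (`𝓛^{GŠ}(U) = −𝓛_U`) and
Hou–Wang–Yang 2025 use the opposite sign.

The published implications are NOT proved here (they are PDE theorems whose proofs — JS15 §3 singular
perturbation, §4 unstable manifold, §5 truncation — are far from Mathlib); they are recorded as the two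
fields of the HYPOTHESIS structure `JS15Leaves`, each a verbatim quotation with page, never as an axiom or
an instance. The assembly theorems `assembly_A` / `assembly_B` are the modus ponens that make explicit
WHICH hypotheses are consumed. `not_spectralA_of_real_crossing` / `not_spectralB_of_no_kernel` are the
kill criteria used by the divergence analysis in `Divergence.lean`.

## What is deliberately NOT here

* No instantiation of `Setting` by the actual operator `𝓛_U` on `X` (no spectral theory available).
* No proof of Thm. 5.1 / 5.2 and no named fact for them: `JS15Leaves` is a hypothesis structure.
* The clauses of the printed conclusion that `∃ T v₀ u v, 0 < T ∧ JS15Datum v₀ ∧ IsNonUniqLHPair T v₀ u v` DROPS: smoothness of the two solutions on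
  `ℝ³ × (0, 1)` (Thm. 5.1) / `ℝ³ × (0, ∞)` (Thm. 5.2); that the datum is `C^∞(ℝ³∖{0})`; the printed time
  interval (`(0, 1)`). The `O(1/|x|)` singularity at the origin is kept as an explicit bound.

## References

* H. Jia, V. Šverák, J. Funct. Anal. 268 (2015), §1 (p.2–4: (A), (B), `X`, `𝒟`, `Y`), §4 (p.12:
  (4.5)–(4.6) = ND1, ND2; Thm. 4.1, 4.2), §5 (p.13: Thm. 5.1, 5.2). [JiaSverak2015]
* H. Jia, V. Šverák, Invent. Math. 196 (2014) 233–265 (existence of the scale-invariant profiles,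
  Thm. 1.1; decay, Thm. 4.1). [JiaSverak2014]
* J. Guillod, V. Šverák, J. Math. Fluid Mech. 25 (2023) (numerics; opposite sign). [GuillodSverak2023]
* D. Albritton, E. Brué, M. Colombo, Ann. of Math. 196 (2022) (the FORCED case; sentence after Thm. 1.2
  for the continuation to global solutions). [AlbrittonBrueColombo2022AnnMath]
-/

open MeasureTheory Set Filter Topology

namespace Literature.Analysis.FluidPDE.JiaSverak2015

/-- Local notation for physical space `ℝ³ = EuclideanSpace ℝ (Fin 3)`. -/
local notation "ℝ³" => EuclideanSpace ℝ (Fin 3)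

/-! ## The conclusion, bound to the tree's Leray–Hopf notion -/

/-- **The JS15 datum class** (Jia–Šverák 2015, Thm. 1.3 p.4 and Thm. 5.2 p.13): a divergence-free
`v₀ ∈ L²(ℝ³)`, compactly supported ("compactly supported initial data `v₀`", Thm. 1.3), with
`‖v₀(x)‖ ≤ C/‖x‖` near `0` ("`v₀(x) = O(1/|x|)` near origin"). Dropped: `v₀ ∈ C^∞(ℝ³∖{0})` (see the
module docstring). A predicate on the datum, not a fact. [cite: JiaSverak2015, Thm. 1.3 p.4; Thm. 5.2 p.13] -/
structure JS15Datum (v₀ : ℝ³ → ℝ³) : Prop where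
  memLp : MemLp v₀ 2 volume
  divFree : IsWeaklyDivFree v₀
  compact : HasCompactSupport v₀
  nearOrigin : ∃ C r : ℝ, 0 < r ∧ ∀ x : ℝ³, 0 < ‖x‖ → ‖x‖ < r → ‖v₀ x‖ ≤ C / ‖x‖

/-- **A non-unique Leray–Hopf pair on `[0, T)`**: two strict-sense Leray–Hopf weak solutions (`IsLerayHopfOn`,
viscosity `1`, no force) of the unforced Navier–Stokes system on `ℝ³ × [0, T)` with the same datum `v₀`
that differ on a set of positive measure at some time `t ∈ (0, T]`. Dropped from the printed conclusion:
smoothness of the two solutions for `t > 0`. The CONCLUSION of JS15 Thm. 1.3 / 5.1 / 5.2 is then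
`∃ T v₀ u v, 0 < T ∧ JS15Datum v₀ ∧ IsNonUniqLHPair T v₀ u v` — written out at every use, never minted as
a closed named Prop (it is the open local form of ns.S19 `LerayHopfNonUniqueness`, Buckmaster–Vicol 2019
§8 Problem 9, proved in print only conditionally). [cite: JiaSverak2015, Thm. 5.2 p.13] -/
def IsNonUniqLHPair (T : ℝ) (v₀ : ℝ³ → ℝ³) (u v : ℝ → ℝ³ → ℝ³) : Prop :=
  IsLerayHopfOn T 1 0 v₀ u ∧ IsLerayHopfOn T 1 0 v₀ v ∧ ∃ t ∈ Ioc 0 T, ¬ (u t =ᵐ[volume] v t)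

/-- The JS15 conclusion implies the tree's statement ns.S19 `LerayHopfNonUniqueness` (global
Leray–Hopf non-uniqueness) granted the continuation hypothesis `hext` — the EXPLICIT binder of
`LerayHopfNonUniqueness.of_isLerayHopfOn`, kept explicit here as well (no named fact is minted for it: the
printed remark of Albritton–Brué–Colombo 2022 after Thm. 1.2 concerns their forced solutions, "by modifying
the force after T", and is not a statement of the unforced restart-and-glue property). [folklore] -/
theorem lerayHopfNonUniqueness_of_local
    (hext : ∀ (T : ℝ) (v₀ : ℝ³ → ℝ³) (u : ℝ → ℝ³ → ℝ³), MemLp v₀ 2 volume → IsWeaklyDivFree v₀ →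
      IsLerayHopfOn T 1 0 v₀ u → ∃ w : ℝ → ℝ³ → ℝ³, IsGlobalLerayHopf 1 0 v₀ w ∧ ∀ t ∈ Ioc 0 T, w t = u t)
    (h : ∃ (T : ℝ) (v₀ : ℝ³ → ℝ³) (u v : ℝ → ℝ³ → ℝ³), 0 < T ∧ JS15Datum v₀ ∧ IsNonUniqLHPair T v₀ u v) :
    LerayHopfNonUniqueness := by
  obtain ⟨T, v₀, u, v, hT, hd, hu, hv, hne⟩ := h
  exact LerayHopfNonUniqueness.of_isLerayHopfOn one_pos hd.memLp hd.divFree hu hv hne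
    (fun w hw => hext T v₀ w hd.memLp hd.divFree hw)

/-! ## The abstract setting of JS15 §1 -/

/-- Abstract setting of JS15 §1 (p.2–4) for a fixed scale-invariant datum `u₀ ∈ C^∞(ℝ³∖{0})`,
divergence free: the objects the spectral conditions (A) and (B) quantify over. No analysis is encoded;
an instantiation by the operator `𝓛_U` on `X = L²∩L⁴` is a future deliverable. [cite: JiaSverak2015, §1 p.2–4] -/
structure Setting where
  /-- the Banach space `X = {φ ∈ L²∩L⁴(ℝ³): div φ = 0}` (JS15 p.3), as a bare carrier. -/
  X : Type
  /-- `branchExists σ`: the profile `U_σ` (solution of JS15 (1.5) p.2 with datum `σ u₀`,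
  `|U_σ − σ e^Δu₀| = o(1/|x|)`, obtained by continuation from `σ = 0`) exists as a regular point of the
  curve. -/
  branchExists : ℝ → Prop
  /-- `eig σ`: the set of eigenvalues of `𝓛_σ = 𝓛 − 𝒦(U_σ)` on the domain `𝒟 ⊂ X` (p.3; FULL domain, all
  perturbations — not only axisymmetric ones). -/
  eig : ℝ → Set ℂ
  /-- `simple σ λ`: `λ` is a simple eigenvalue of `𝓛_σ` (JS15 (A)/(B), p.3). -/
  simple : ℝ → ℂ → Prop
  /-- `inRange σ w`: `w ∈ Range(𝓛_σ)` (JS15 (4.5)–(4.6), p.12). -/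
  inRange : ℝ → X → Prop
  /-- the vector `ℙ(U_{σ₀}·∇U + U·∇U_{σ₀})`, `U := e^Δ u₀` (JS15 p.12, (4.5)). -/
  nd1Vector : ℝ → X
  /-- the vector `ℙ(v·∇v)` for `v` a unit kernel vector of `𝓛_{σ₀}` (JS15 p.12, (4.6)). -/
  nd2Vector : ℝ → X

namespace Setting

variable (S : Setting)

/-- JS15 scenario **(A)** (p.3), verbatim, at crossing parameter `σ₀` with gap `δ`: for `σ ≤ σ₀` the
eigenvalues of `𝓛_σ` lie in `{Re λ < −δ} ∪ {lam₁(σ), conj lam₁(σ)}`, these two are simple eigenvalues,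
`Re lam₁(σ) < 0` for `σ < σ₀`, `Re lam₁(σ₀) = 0`, `Im lam₁(σ₀) > 0`, and `(d/dσ) Re lam₁ (σ₀) > 0`.
[cite: JiaSverak2015, §1 (A) p.3] -/
def SpectralA (σ₀ δ : ℝ) : Prop :=
  0 < δ ∧ (∀ σ ≤ σ₀, S.branchExists σ) ∧
  ∃ lam₁ : ℝ → ℂ,
    (∀ σ ≤ σ₀, S.eig σ ⊆ {z | z.re < -δ} ∪ {lam₁ σ, (starRingEnd ℂ) (lam₁ σ)}) ∧
    (∀ σ ≤ σ₀, lam₁ σ ∈ S.eig σ ∧ S.simple σ (lam₁ σ) ∧ S.simple σ ((starRingEnd ℂ) (lam₁ σ))) ∧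
    (∀ σ < σ₀, (lam₁ σ).re < 0) ∧ (lam₁ σ₀).re = 0 ∧ 0 < (lam₁ σ₀).im ∧
    ∃ d : ℝ, 0 < d ∧ HasDerivAt (fun σ => (lam₁ σ).re) d σ₀

/-- JS15 scenario **(B)** (p.3), verbatim: for `σ ≤ σ₀` the eigenvalues lie in `{Re λ < −δ} ∪ {lam₁(σ)}`,
`lam₁(σ)` is a simple REAL eigenvalue, `lam₁(σ) < 0` for `σ < σ₀`, `lam₁(σ₀) = 0`.
[cite: JiaSverak2015, §1 (B) p.3] -/
def SpectralB (σ₀ δ : ℝ) : Prop :=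
  0 < δ ∧ (∀ σ ≤ σ₀, S.branchExists σ) ∧
  ∃ lam₁ : ℝ → ℝ,
    (∀ σ ≤ σ₀, S.eig σ ⊆ {z | z.re < -δ} ∪ {(lam₁ σ : ℂ)}) ∧
    (∀ σ ≤ σ₀, (lam₁ σ : ℂ) ∈ S.eig σ ∧ S.simple σ (lam₁ σ)) ∧
    (∀ σ < σ₀, lam₁ σ < 0) ∧ lam₁ σ₀ = 0

/-- JS15 (4.5), p.12: `ℙ(U_{σ₀}·∇U + U·∇U_{σ₀}) ∉ Range(𝓛_{σ₀})`. [cite: JiaSverak2015, (4.5) p.12] -/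
def ND1 (σ₀ : ℝ) : Prop := ¬ S.inRange σ₀ (S.nd1Vector σ₀)

/-- JS15 (4.6), p.12: `ℙ(v·∇v) ∉ Range(𝓛_{σ₀})`, `v` a unit kernel vector. [cite: JiaSverak2015, (4.6) p.12] -/
def ND2 (σ₀ : ℝ) : Prop := ¬ S.inRange σ₀ (S.nd2Vector σ₀)

/-- The **published leaves** of the programme, each a verbatim quotation. A structure, i.e. a HYPOTHESIS
handed to the assembly — never an axiom or an instance. CAUTION (review of p175635): `Setting` is
junk-instantiable (e.g. `X := Unit`, `eig σ := {σ + i, σ − i}`, `simple ≡ True` makes `SpectralA 0 1`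
provable), so for such an `S` the hypothesis `S.JS15Leaves` is literally equivalent to the open local
non-uniqueness conclusion; no file may take `JS15Leaves` for an unspecified `S` as given — it is only
meaningful for the `Setting` induced by the actual operator `𝓛_U` on `X`. [cite: JiaSverak2015, Thm. 5.1–5.2 p.13] -/
structure JS15Leaves where
  /-- JS15 Thm. 5.1 (p.13): "Assume the spectral condition (A) holds. Then there exist two different
  Leray–Hopf weak solutions which are smooth in `ℝ³ × (0,1)` with the same initial data
  `v₀ ∈ C^∞(ℝ³∖{0})`, `v₀(x) = O(1/|x|)` near origin." The `HasCompactSupport` conjunct of the conclusion is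
  printed in Thm. 1.3 (p.4), verbatim: "Suppose (A), or (B) together with non-degeneracy conditions in
  Theorem 4.2 holds. Then there exist two different Leray-Hopf weak solutions `u₁` and `u₂` to NSE with
  compactly supported initial data `v₀` which is smooth in `ℝ³∖{0}` and near origin `|v₀(x)| = O(1/|x|)`"
  (and the proof of Thm. 5.1, p.13, decomposes `u₀ = v₀ + w₀` with `v₀` compactly supported).
  [cite: JiaSverak2015, Thm. 1.3 p.4; Thm. 5.1 p.13] -/
  thm51 : ∀ σ₀ δ, S.SpectralA σ₀ δ → (∃ (T : ℝ) (v₀ : ℝ³ → ℝ³) (u v : ℝ → ℝ³ → ℝ³), 0 < T ∧ JS15Datum v₀ ∧ IsNonUniqLHPair T v₀ u v)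
  /-- JS15 Thm. 5.2 (p.13): "Assume the spectral condition (B) and the non-degeneracy conditions (4.5),
  (4.6) hold. Then there exists compactly supported divergence free `v₀ ∈ C^∞(ℝ³∖{0})` with
  `v₀(x) = O(1/|x|)` near origin, such that there are two Leray–Hopf weak solutions with initial data `v₀`.
  Moreover the two Leray–Hopf solutions are smooth in `ℝ³ × (0,∞)`." -/
  thm52 : ∀ σ₀ δ, S.SpectralB σ₀ δ → S.ND1 σ₀ → S.ND2 σ₀ → (∃ (T : ℝ) (v₀ : ℝ³ → ℝ³) (u v : ℝ → ℝ³ → ℝ³), 0 < T ∧ JS15Datum v₀ ∧ IsNonUniqLHPair T v₀ u v)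

/-- Assembly N-A: (A) ⇒ the conclusion, consuming exactly Thm. 5.1. [folklore] -/
theorem assembly_A (L : S.JS15Leaves) {σ₀ δ : ℝ} (hA : S.SpectralA σ₀ δ) : (∃ (T : ℝ) (v₀ : ℝ³ → ℝ³) (u v : ℝ → ℝ³ → ℝ³), 0 < T ∧ JS15Datum v₀ ∧ IsNonUniqLHPair T v₀ u v) :=
  L.thm51 σ₀ δ hA

/-- Assembly N-B: (B) ∧ ND1 ∧ ND2 ⇒ the conclusion, consuming exactly Thm. 5.2. [folklore] -/
theorem assembly_B (L : S.JS15Leaves) {σ₀ δ : ℝ} (hB : S.SpectralB σ₀ δ) (h1 : S.ND1 σ₀)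
    (h2 : S.ND2 σ₀) : (∃ (T : ℝ) (v₀ : ℝ³ → ℝ³) (u v : ℝ → ℝ³ → ℝ³), 0 < T ∧ JS15Datum v₀ ∧ IsNonUniqLHPair T v₀ u v) :=
  L.thm52 σ₀ δ hB h1 h2

/-- (A) ⇒ ns.S19, granted the published leaf and the continuation. [folklore] -/
theorem lerayHopfNonUniqueness_of_spectralA
    (hext : ∀ (T : ℝ) (v₀ : ℝ³ → ℝ³) (u : ℝ → ℝ³ → ℝ³), MemLp v₀ 2 volume → IsWeaklyDivFree v₀ →
      IsLerayHopfOn T 1 0 v₀ u → ∃ w : ℝ → ℝ³ → ℝ³, IsGlobalLerayHopf 1 0 v₀ w ∧ ∀ t ∈ Ioc 0 T, w t = u t)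
    (L : S.JS15Leaves) {σ₀ δ : ℝ} (hA : S.SpectralA σ₀ δ) : LerayHopfNonUniqueness :=
  lerayHopfNonUniqueness_of_local hext (S.assembly_A L hA)

/-! ## Kill criteria -/

/-- **A REAL crossing is not scenario (A).** If at `σ₀` the only eigenvalue on the imaginary axis is `0`
(what a certified real crossing gives — Guillod–Šverák 2023, Result (2): a real simple eigenvalue crosses
`0` at `σ₀ ≈ 292`), then (A) FAILS at that `σ₀`, because (A) demands `Im lam₁(σ₀) > 0` for an eigenvalue
`lam₁(σ₀)` with `Re lam₁(σ₀) = 0`. [folklore] -/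
theorem not_spectralA_of_real_crossing {σ₀ δ : ℝ}
    (hreal : ∀ z ∈ S.eig σ₀, z.re = 0 → z = 0) : ¬ S.SpectralA σ₀ δ := by
  rintro ⟨-, -, lam₁, -, hmem, -, hre, him, -⟩
  have h0 : lam₁ σ₀ = 0 := hreal _ (hmem σ₀ le_rfl).1 hre
  rw [h0] at him
  simp at him

/-- (B) forces `lam₁(σ₀) = 0 ∈ eig σ₀`; so a certified "`0 ∉ eig σ₀`" (no kernel at `σ₀`) refutes (B) at
`σ₀`. [folklore] -/
theorem not_spectralB_of_no_kernel {σ₀ δ : ℝ} (h : (0 : ℂ) ∉ S.eig σ₀) : ¬ S.SpectralB σ₀ δ := by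
  rintro ⟨-, -, lam₁, -, hmem, -, h0⟩
  have := (hmem σ₀ le_rfl).1
  rw [h0] at this
  exact h (by simpa using this)

end Setting

end Literature.Analysis.FluidPDE.JiaSverak2015
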